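import Literature.AlgebraicGeometry.Milne1999.ExteriorInvariantsGeneratedInDegreeTwo
import Literature.AlgebraicGeometry.Motives.HodgeStructurePolarizationAdjointPoints
import Literature.RingTheory.SimpleModule.SemisimpleBaseChange
import HarnessLib

/-!
# Milne 1999, Thm. 3.2 / Prop. 3.4 ON `K`-POINTS OF A POLARIZED `ℚ`-HODGE STRUCTURE: for `(V, H, Q)` of odd weight and an
# algebraically closed field `K ⊇ ℚ`, the invariants of Milne's `S(H)(K) ≤ GL(K ⊗ V)` in the exterior algebra `⋀(K ⊗ V)`
# are generated, as a `K`-algebra, by the invariant `2`-vectors — "`H^*(A^r)^{S(A)} = k[H²(A^r)^{S(A)}]`" (`r = 1`)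

[topic AlgebraicGeometry/Motives]

Layer `Literature/AlgebraicGeometry/Motives`, lane `lit-hodgefound` (Track 2 foundations library; seat `lit-hodgefound-p34`,
generation 25, self-proposed row g25-#2), namespace `Literature.AlgebraicGeometry.Motives.HodgeStructure`. THEOREMS ONLY; no
definition, no named fact, no `sorry` (D-0026, net debt `0`).  Direct sequel of the seat's g25-#1
`Milne1999/ExteriorInvariantsGeneratedInDegreeTwo` (the abstract theorem for a triple `(W, B, E)` and the group `S(E, B)`), read
on the carrier of the seat's g18-#1 `Motives/HodgeStructureLefschetzGroupPoints`: `W = K ⊗_ℚ V`, `B = Q_K`, `E = E_φ ⊗ K`,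
`S(E, B) = S(H)(K) = Polarization.lefschetzGroupBaseChange K Q`.

## The source, verbatim

J. S. Milne, *Lefschetz classes on abelian varieties*, Duke Math. J. **96** (1999) 639–675 [`Milne1999LefschetzClasses`, held
`paper:doi-10-1215-s0012-7094-99-09620-5`; PDF page = printed page − 638]:
* §1 p. 644 L16–L20: "`S(A)(R) = {γ ∈ C(A) ⊗_k R | γ†γ = 1}`. Thus, for any ample divisor `D` on `A`, `S(A)` is the largest
  algebraic subgroup of `Sp(e_D)` whose elements commute with the endomorphisms of `A`"; §1 p. 642: "`End⁰(A)` is a semisimple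
  `ℚ`-algebra", §2 p. 645: "`(E ⊗ k, †)` […] semisimple `k`-algebra with involution";
* §3 p. 653 (p0015 L20–L36): "we obtain an action of `S(A)` on `H^*(A^r)` for all `r`. […] **Theorem 3.2.** […] the `k`-algebra
  `H^*(A^r)^{S(A)}` is generated by divisor classes. […] **Proposition 3.4.** For any abelian variety `A` over `Ω` and any
  integer `r`, `H^*(A^r)^{S(A)} = k[H²(A^r)^{S(A)}]`"; Lemma 3.1 (p. 652): "we may assume `k` to be algebraically closed"; p. 656
  (end of the proof of Prop. 3.4).

## What is proved (any finite-dimensional polarized `ℚ`-Hodge structure `(V, H, Q)`; `K ⊇ ℚ` a field; `W = K ⊗_ℚ V`)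

* §1 **`E_φ ⊗ K` as a `K`-subalgebra of `End_K(W)`**, spelled `Algebra.adjoin K {a_K | a ∈ E_φ}` (no new definition; its
  underlying `K`-submodule is the `K`-span of the `a_K` already used throughout the seat's g17–g24 files,
  `toSubmodule_adjoin_baseChange_endAlg_eq_span`): it is the range of `K ⊗_ℚ E_φ → End_K(W)`, `c ⊗ a ↦ c · a_K`
  (`range_baseChangeEndAlgHom_eq_adjoin`, the map written out as `Algebra.TensorProduct.lift`), hence **semisimple** for polarizable `H` (Poincaré/Moonen: `E_φ` semisimple, the
  tree's `isSemisimpleRing_endAlg`; base change in characteristic `0`, the tree's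
  `RingTheory/SimpleModule/SemisimpleBaseChange.isSemisimpleRing_baseChange`; a quotient of a semisimple ring is semisimple) —
  `isSemisimpleRing_adjoin_baseChange_endAlg`; and **`†`-stable** for `† = Q.adjointBaseChange K`
  (`Polarization.adjointBaseChange_mem_adjoin_baseChange_endAlg`, `Polarization.exists_mem_adjoin_baseChange_form_apply`).
* §2 `Q_K` is alternating for odd weight over every `K` (`Polarization.baseChange_form_isAlt_of_odd`); membership in `S(H)(K)`
  is "commutes with `E_φ ⊗ K` and preserves `Q_K`" (`Polarization.mem_lefschetzGroupBaseChange_iff_forall_adjoin`).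
* §3 **Prop. 3.4 (`r = 1`) on `K`-points, `K` algebraically closed, odd weight**:
  `Polarization.mem_adjoin_of_forall_lefschetzGroupBaseChange_map_eq` — every `x ∈ ⋀^m W` fixed by `⋀(γ)` for all
  `γ ∈ S(H)(K)` lies in `K[(⋀² W)^{S(H)(K)}]`; the `⋀[K]^m W` / `exteriorPower.map` form; the whole-algebra form and
  **`Polarization.setOf_forall_lefschetzGroupBaseChange_map_eq_eq_adjoin`: `(⋀ W)^{S(H)(K)} = K[(⋀² W)^{S(H)(K)}]` as sets**;
  odd degrees carry no invariants over ANY `K ⊇ ℚ` (`Polarization.eq_zero_of_forall_lefschetzGroupBaseChange_map_eq_of_odd`).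

NOT here: Prop. 3.3 in covariant form (the invariant `2`-vectors are those of the `†`-symmetric elements of `E_φ ⊗ K`, hence
"divisor classes") and Thm. 3.2 literally — the next row; even weight (`Q_K` symmetric: the adapted colouring of the tree is for
alternating `B`); `r ≥ 2`; descent to non-closed `K` (Lemma 3.1).

## References

* [Milne1999LefschetzClasses] J. S. Milne, Lefschetz classes on abelian varieties, Duke Math. J. 96 (1999) 639–675: §1 pp.
  642–644, §2 p. 645, §3 Lemma 3.1, Thm. 3.2, Prop. 3.3, Prop. 3.4 (pp. 652–653), p. 656.
* [Moonen2017FamiliesMotives] B. Moonen, Families of motives and the Mumford–Tate conjecture (2017), §2.1 (`End_HS` semisimple).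
* [Pierce1982] R. S. Pierce, Associative Algebras, GTM 88 (1982), §10.6–§10.7 (semisimplicity under base change).
* [BourbakiAlgebraI1989] N. Bourbaki, Algebra I, Ch. II §5 no. 3 Prop. 7 and Ch. III §7 (base change of endomorphisms, `⋀(u)`).
-/

noncomputable section

open scoped TensorProduct

namespace Literature.AlgebraicGeometry.Motives

namespace HodgeStructure

universe u uK

variable (K : Type uK) [Field K] [Algebra ℚ K] {V : Type u} [AddCommGroup V] [Module ℚ V] [Module.Finite ℚ V] {n : ℤ}

/-! ### §1 `E_φ ⊗ K ⊆ End_K(K ⊗ V)` as a `K`-subalgebra: range of `K ⊗_ℚ E_φ`, semisimple, `†`-stable -/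

section EndAlgBaseChange

variable (H : HodgeStructure V n)

omit [Module.Finite ℚ V] in
/-- `(c ⊗ a) ↦ c · a_K` under the `K`-algebra map `K ⊗_ℚ E_φ → End_K(K ⊗ V)` (Mathlib's `Algebra.TensorProduct.lift` of
`K → End_K` and `a ↦ a_K = Module.End.baseChangeHom`; written out, no definition). Private plumbing.
[cite: BourbakiAlgebraI1989, Ch. II §5 no. 3 Prop. 7] -/
private theorem lift_baseChangeHom_tmul (c : K) (a : H.endAlg) :
    Algebra.TensorProduct.lift (Algebra.ofId K (Module.End K (K ⊗[ℚ] V)))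
        ((Module.End.baseChangeHom ℚ K V).comp H.endAlg.val) (fun c _ ↦ Algebra.commute_algebraMap_left c _)
        (c ⊗ₜ[ℚ] a) = c • (a : Module.End ℚ V).baseChange K := by
  rw [Algebra.TensorProduct.lift_tmul, Algebra.ofId_apply, ← Algebra.smul_def]
  rfl

omit [Module.Finite ℚ V] in
/-- The image of `K ⊗_ℚ E_φ → End_K(K ⊗ V)` lies in the `K`-span of the `a_K`. Private plumbing.
[cite: BourbakiAlgebraI1989, Ch. II §5 no. 3 Prop. 7] -/
private theorem lift_baseChangeHom_mem_span (r : K ⊗[ℚ] H.endAlg) :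
    Algebra.TensorProduct.lift (Algebra.ofId K (Module.End K (K ⊗[ℚ] V)))
        ((Module.End.baseChangeHom ℚ K V).comp H.endAlg.val) (fun c _ ↦ Algebra.commute_algebraMap_left c _) r ∈
      Submodule.span K (Set.range fun a : H.endAlg ↦ (a : Module.End ℚ V).baseChange K) := by
  induction r using TensorProduct.induction_on with
  | zero => rw [map_zero]; exact Submodule.zero_mem _
  | tmul c a =>
    rw [lift_baseChangeHom_tmul]
    exact Submodule.smul_mem _ c (Submodule.subset_span ⟨a, rfl⟩)
  | add x y hx hy => rw [map_add]; exact Submodule.add_mem _ hx hy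

omit [Module.Finite ℚ V] in
/-- **`E_φ ⊗ K = K[a_K | a ∈ E_φ]` is the image of `K ⊗_ℚ E_φ` in `End_K(K ⊗ V)`** under `c ⊗ a ↦ c · a_K` ("`End⁰(A) ⊗_ℚ k`"
acting on `V(A) ⊗ k`; the map written out as Mathlib's `Algebra.TensorProduct.lift` of `K → End_K` and
`a ↦ a_K = Module.End.baseChangeHom`, no definition). [cite: Milne1999LefschetzClasses, §1 Remark 1.2 (p. 643) and Remark 1.6 (p. 644)]
[cite: BourbakiAlgebraI1989, Ch. II §5 no. 3 Prop. 7] -/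
theorem range_lift_baseChangeHom_eq_adjoin :
    (Algebra.TensorProduct.lift (Algebra.ofId K (Module.End K (K ⊗[ℚ] V)))
        ((Module.End.baseChangeHom ℚ K V).comp H.endAlg.val) (fun c _ ↦ Algebra.commute_algebraMap_left c _)).range =
      Algebra.adjoin K (Set.range fun a : H.endAlg ↦ (a : Module.End ℚ V).baseChange K) := by
  refine le_antisymm (fun X hX ↦ ?_) (Algebra.adjoin_le ?_)
  · obtain ⟨r, rfl⟩ := (AlgHom.mem_range _).1 hX
    exact Algebra.span_le_adjoin K _ (lift_baseChangeHom_mem_span K H r)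
  · rintro _ ⟨a, rfl⟩
    exact (AlgHom.mem_range _).2 ⟨(1 : K) ⊗ₜ[ℚ] a, by rw [lift_baseChangeHom_tmul, one_smul]⟩

omit [Module.Finite ℚ V] in
/-- **The underlying `K`-module of `K[a_K | a ∈ E_φ]` is the `K`-span of the `a_K`** (the spelling of `E_φ ⊗ K` used by the
tree's `K`-points files, e.g. `forall_centralizer_endAlg_baseChange_comm_iff_mem_span_baseChange_endAlg`): the `a_K` are closed
under products, `a_K b_K = (ab)_K`. [cite: Milne1999LefschetzClasses, §1 Remark 1.2 (p. 643) and Remark 1.6 (p. 644)] -/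
theorem toSubmodule_adjoin_baseChange_endAlg_eq_span :
    Subalgebra.toSubmodule (Algebra.adjoin K (Set.range fun a : H.endAlg ↦ (a : Module.End ℚ V).baseChange K)) =
      Submodule.span K (Set.range fun a : H.endAlg ↦ (a : Module.End ℚ V).baseChange K) := by
  refine le_antisymm (fun X hX ↦ ?_) (Algebra.span_le_adjoin K _)
  rw [Subalgebra.mem_toSubmodule, ← range_lift_baseChangeHom_eq_adjoin] at hX
  obtain ⟨r, rfl⟩ := (AlgHom.mem_range _).1 hX
  exact lift_baseChangeHom_mem_span K H r

omit [Module.Finite ℚ V] in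
/-- Membership form of the previous statement. [cite: Milne1999LefschetzClasses, §1 Remark 1.2 (p. 643)] -/
theorem mem_adjoin_baseChange_endAlg_iff_mem_span (X : Module.End K (K ⊗[ℚ] V)) :
    X ∈ Algebra.adjoin K (Set.range fun a : H.endAlg ↦ (a : Module.End ℚ V).baseChange K) ↔
      X ∈ Submodule.span K (Set.range fun a : H.endAlg ↦ (a : Module.End ℚ V).baseChange K) := by
  rw [← Subalgebra.mem_toSubmodule, toSubmodule_adjoin_baseChange_endAlg_eq_span]

set_option maxSynthPendingDepth 4 in
/-- **`E_φ ⊗ K` is a semisimple ring for polarizable `H` and every field `K ⊇ ℚ`** ("`End⁰(A)` is a semisimple `ℚ`-algebra",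
"`(E ⊗ k, †)` […] semisimple"): `E_φ` is semisimple (Poincaré–Moonen, the tree's `isSemisimpleRing_endAlg`), `K ⊗_ℚ E_φ` is
semisimple (characteristic `0`, the tree's `SemisimpleBaseChange.isSemisimpleRing_baseChange`), and `E_φ ⊗ K ⊆ End_K(K ⊗ V)`
is its image (a quotient of a semisimple ring is semisimple). [cite: Milne1999LefschetzClasses, §1 p. 642 and §2 p. 645]
[cite: Moonen2017FamiliesMotives, §2.1] [cite: Pierce1982, §10.7 Cor. b and §10.6 Cor.] -/
theorem isSemisimpleRing_adjoin_baseChange_endAlg (hH : H.IsPolarizable) :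
    IsSemisimpleRing (Algebra.adjoin K (Set.range fun a : H.endAlg ↦ (a : Module.End ℚ V).baseChange K)) := by
  haveI : IsSemisimpleRing H.endAlg := isSemisimpleRing_endAlg hH
  haveI : Module.Finite ℚ H.endAlg := finite_endAlg H
  haveI : IsSemisimpleRing (K ⊗[ℚ] H.endAlg) :=
    Literature.RingTheory.SimpleModule.isSemisimpleRing_baseChange ℚ H.endAlg K
  rw [← range_lift_baseChangeHom_eq_adjoin K H]
  refine RingHom.isSemisimpleRing_of_surjective
    (Algebra.TensorProduct.lift (Algebra.ofId K (Module.End K (K ⊗[ℚ] V)))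
      ((Module.End.baseChangeHom ℚ K V).comp H.endAlg.val)
      (fun c _ ↦ Algebra.commute_algebraMap_left c _)).rangeRestrict.toRingHom fun y ↦ ?_
  obtain ⟨x, hx⟩ := (AlgHom.mem_range _).1 y.2
  exact ⟨x, Subtype.ext hx⟩

variable {H}
variable (Q : Polarization H)

/-- **`E_φ ⊗ K` is `†`-stable** (`†` the `Q_K`-adjoint of `Motives/HodgeStructurePolarizationAdjointPoints`; Rosati stability
of `E_φ` read with coefficients in `K`). [cite: Milne1999LefschetzClasses, §1 p. 642 L70–L71 and §2 p. 645] -/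
theorem Polarization.adjointBaseChange_mem_adjoin_baseChange_endAlg {X : Module.End K (K ⊗[ℚ] V)}
    (hX : X ∈ Algebra.adjoin K (Set.range fun a : H.endAlg ↦ (a : Module.End ℚ V).baseChange K)) :
    Q.adjointBaseChange K X ∈ Algebra.adjoin K (Set.range fun a : H.endAlg ↦ (a : Module.End ℚ V).baseChange K) := by
  rw [mem_adjoin_baseChange_endAlg_iff_mem_span] at hX ⊢
  exact Q.adjointBaseChange_mem_span_baseChange_endAlg K hX

/-- The `†`-stability of `E_φ ⊗ K` in the shape consumed by the abstract theorem (`hE` of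
`Milne1999.mem_adjoin_of_forall_map_eq`): for `X ∈ E_φ ⊗ K` the element `Y = X† ∈ E_φ ⊗ K` satisfies `Q_K(Y v, w) = Q_K(v, X w)`.
[cite: Milne1999LefschetzClasses, §1 p. 642 L64–L71 and §2 p. 645] -/
theorem Polarization.exists_mem_adjoin_baseChange_form_apply {X : Module.End K (K ⊗[ℚ] V)}
    (hX : X ∈ Algebra.adjoin K (Set.range fun a : H.endAlg ↦ (a : Module.End ℚ V).baseChange K)) :
    ∃ Y ∈ Algebra.adjoin K (Set.range fun a : H.endAlg ↦ (a : Module.End ℚ V).baseChange K),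
      ∀ v w, Q.form.baseChange K (Y v) w = Q.form.baseChange K v (X w) :=
  ⟨Q.adjointBaseChange K X, Q.adjointBaseChange_mem_adjoin_baseChange_endAlg K hX,
    fun v w ↦ Q.baseChange_form_adjointBaseChange_apply K X v w⟩

end EndAlgBaseChange

/-! ### §2 `Q_K` is alternating for odd weight; `S(H)(K)` = "commutes with `E_φ ⊗ K`, preserves `Q_K`" -/

section LefschetzGroup

variable {H : HodgeStructure V n} (Q : Polarization H)

omit [Module.Finite ℚ V] in
/-- **For odd weight `Q_K` is alternating over every field `K ⊇ ℚ`** ("a skew-symmetric pairing `e_D`", Remark 1.6: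
`Q_K(x, x) = (-1)ⁿ Q_K(x, x) = −Q_K(x, x)` and `2 ≠ 0`). [cite: Milne1999LefschetzClasses, §1 p. 642 L62–L63 and Remark 1.6 (p. 644)] -/
theorem Polarization.baseChange_form_isAlt_of_odd (hn : Odd n) : (Q.form.baseChange K).IsAlt := by
  haveI : CharZero K := charZero_of_injective_algebraMap (algebraMap ℚ K).injective
  intro x
  have h := Q.baseChange_form_swap K x x
  rw [Int.negOnePow_odd n hn, Units.val_neg, Units.val_one, Int.cast_neg, Int.cast_one, neg_one_mul] at h
  have h2 : (2 : K) * Q.form.baseChange K x x = 0 := by rw [two_mul]; nth_rewrite 1 [h]; exact neg_add_cancel _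
  exact (mul_eq_zero.1 h2).resolve_left two_ne_zero

omit [Module.Finite ℚ V] in
/-- **`γ ∈ S(H)(K)` iff `γ` commutes with every element of `E_φ ⊗ K = K[a_K | a ∈ E_φ]` and preserves `Q_K`** — the membership
test `hG` of the abstract theorem (commutation with the generators `a_K` extends to the generated `K`-algebra).
[cite: Milne1999LefschetzClasses, §1 p. 644 L16–L20] -/
theorem Polarization.mem_lefschetzGroupBaseChange_iff_forall_adjoin (γ : (K ⊗[ℚ] V) ≃ₗ[K] (K ⊗[ℚ] V)) :
    γ ∈ Q.lefschetzGroupBaseChange K ↔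
      (∀ X ∈ Algebra.adjoin K (Set.range fun a : H.endAlg ↦ (a : Module.End ℚ V).baseChange K), ∀ v, X (γ v) = γ (X v)) ∧
        ∀ v w, Q.form.baseChange K (γ v) (γ w) = Q.form.baseChange K v w := by
  rw [Q.mem_lefschetzGroupBaseChange_iff]
  refine ⟨fun h ↦ ⟨fun X hX ↦ ?_, h.2⟩, fun h ↦ ⟨fun a v ↦ h.1 _ (Algebra.subset_adjoin ⟨a, rfl⟩) v, h.2⟩⟩
  induction hX using Algebra.adjoin_induction with
  | mem X hX' =>
    obtain ⟨a, rfl⟩ := hX'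
    exact h.1 a
  | algebraMap c => intro v; simp [Algebra.algebraMap_eq_smul_one]
  | add X Y _ _ hX hY => intro v; rw [LinearMap.add_apply, LinearMap.add_apply, map_add, hX, hY]
  | mul X Y _ _ hX hY => intro v; rw [Module.End.mul_apply, Module.End.mul_apply, hY, hX]

end LefschetzGroup

/-! ### §3 Prop. 3.4 on `K`-points: the `S(H)(K)`-invariants of `⋀(K ⊗ V)` are generated by the invariant `2`-vectors -/

section Main

variable {H : HodgeStructure V n} (Q : Polarization H)

set_option maxSynthPendingDepth 4 in
/-- **Milne 1999, Prop. 3.4 (`r = 1`) on `K`-points for a polarized `ℚ`-Hodge structure of odd weight, `K ⊇ ℚ` algebraically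
closed: `(⋀^m(K ⊗ V))^{S(H)(K)} ⊆ K[(⋀²(K ⊗ V))^{S(H)(K)}]`** — every `x ∈ ⋀^m W`, `W = K ⊗_ℚ V`, with `⋀(γ) x = x` for all
`γ ∈ S(H)(K)` lies in the `K`-subalgebra of `⋀ W` generated by the `S(H)(K)`-invariant `2`-vectors ("`H^*(A^r)^{S(A)} =
k[H²(A^r)^{S(A)}]`": the abstract theorem `Milne1999.mem_adjoin_of_forall_map_eq` of the seat's g25-#1 for `(W, Q_K, E_φ ⊗ K)`,
whose hypotheses are §1–§2).
[cite: Milne1999LefschetzClasses, Thm. 3.2 and Prop. 3.4 (p. 653), Lemma 3.1 (p. 652), §2 p. 645, p. 656] -/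
theorem Polarization.mem_adjoin_of_forall_lefschetzGroupBaseChange_map_eq [IsAlgClosed K] (hn : Odd n) {m : ℕ}
    {x : ExteriorAlgebra K (K ⊗[ℚ] V)} (hxm : x ∈ ⋀[K]^m (K ⊗[ℚ] V))
    (hx : ∀ γ ∈ Q.lefschetzGroupBaseChange K, ExteriorAlgebra.map (γ : (K ⊗[ℚ] V) →ₗ[K] (K ⊗[ℚ] V)) x = x) :
    x ∈ Algebra.adjoin K {y : ExteriorAlgebra K (K ⊗[ℚ] V) | y ∈ ⋀[K]^2 (K ⊗[ℚ] V) ∧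
      ∀ γ ∈ Q.lefschetzGroupBaseChange K, ExteriorAlgebra.map (γ : (K ⊗[ℚ] V) →ₗ[K] (K ⊗[ℚ] V)) y = y} := by
  haveI : CharZero K := charZero_of_injective_algebraMap (algebraMap ℚ K).injective
  haveI := isSemisimpleRing_adjoin_baseChange_endAlg K H ⟨Q⟩
  exact Milne1999.mem_adjoin_of_forall_map_eq (Q.baseChange_form_nondegenerate K) (Q.baseChange_form_isAlt_of_odd K hn)
    (Algebra.adjoin K (Set.range fun a : H.endAlg ↦ (a : Module.End ℚ V).baseChange K))
    (fun X hX ↦ Q.exists_mem_adjoin_baseChange_form_apply K hX) (Q.lefschetzGroupBaseChange K)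
    (fun γ ↦ Q.mem_lefschetzGroupBaseChange_iff_forall_adjoin K γ) hxm hx

set_option maxSynthPendingDepth 4 in
/-- **The same on Mathlib's graded piece `x : ⋀[K]^m (K ⊗ V)`, `γ` acting by `exteriorPower.map m γ`.**
[cite: Milne1999LefschetzClasses, Thm. 3.2 and Prop. 3.4 (p. 653)] -/
theorem Polarization.coe_mem_adjoin_of_forall_lefschetzGroupBaseChange_exteriorPower_map_eq [IsAlgClosed K] (hn : Odd n)
    {m : ℕ} (x : ⋀[K]^m (K ⊗[ℚ] V))
    (hx : ∀ γ ∈ Q.lefschetzGroupBaseChange K, exteriorPower.map m (γ : (K ⊗[ℚ] V) →ₗ[K] (K ⊗[ℚ] V)) x = x) :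
    (x : ExteriorAlgebra K (K ⊗[ℚ] V)) ∈ Algebra.adjoin K {y : ExteriorAlgebra K (K ⊗[ℚ] V) | y ∈ ⋀[K]^2 (K ⊗[ℚ] V) ∧
      ∀ γ ∈ Q.lefschetzGroupBaseChange K, ExteriorAlgebra.map (γ : (K ⊗[ℚ] V) →ₗ[K] (K ⊗[ℚ] V)) y = y} :=
  Q.mem_adjoin_of_forall_lefschetzGroupBaseChange_map_eq K hn x.2 fun γ hγ ↦ by
    rw [← ExteriorLefschetz.coe_exteriorPower_map, hx γ hγ]

set_option maxSynthPendingDepth 4 in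
/-- **The whole algebra: every `S(H)(K)`-invariant element of `⋀(K ⊗ V)` (homogeneous or not) is a polynomial in invariant
`2`-vectors.** [cite: Milne1999LefschetzClasses, Thm. 3.2 and Prop. 3.4 (p. 653)] -/
theorem Polarization.mem_adjoin_of_forall_lefschetzGroupBaseChange_map_eq' [IsAlgClosed K] (hn : Odd n)
    {x : ExteriorAlgebra K (K ⊗[ℚ] V)}
    (hx : ∀ γ ∈ Q.lefschetzGroupBaseChange K, ExteriorAlgebra.map (γ : (K ⊗[ℚ] V) →ₗ[K] (K ⊗[ℚ] V)) x = x) :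
    x ∈ Algebra.adjoin K {y : ExteriorAlgebra K (K ⊗[ℚ] V) | y ∈ ⋀[K]^2 (K ⊗[ℚ] V) ∧
      ∀ γ ∈ Q.lefschetzGroupBaseChange K, ExteriorAlgebra.map (γ : (K ⊗[ℚ] V) →ₗ[K] (K ⊗[ℚ] V)) y = y} := by
  haveI : CharZero K := charZero_of_injective_algebraMap (algebraMap ℚ K).injective
  haveI := isSemisimpleRing_adjoin_baseChange_endAlg K H ⟨Q⟩
  exact Milne1999.mem_adjoin_of_forall_map_eq' (Q.baseChange_form_nondegenerate K) (Q.baseChange_form_isAlt_of_odd K hn)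
    (Algebra.adjoin K (Set.range fun a : H.endAlg ↦ (a : Module.End ℚ V).baseChange K))
    (fun X hX ↦ Q.exists_mem_adjoin_baseChange_form_apply K hX) (Q.lefschetzGroupBaseChange K)
    (fun γ ↦ Q.mem_lefschetzGroupBaseChange_iff_forall_adjoin K γ) hx

set_option maxSynthPendingDepth 4 in
/-- **"`H^*(A^r)^{S(A)} = k[H²(A^r)^{S(A)}]`" (`r = 1`) on `K`-points, as an equality of sets**: for a polarized `ℚ`-Hodge
structure of odd weight and an algebraically closed `K ⊇ ℚ`, the `S(H)(K)`-invariants of `⋀(K ⊗ V)` ARE the `K`-subalgebra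
generated by the invariant `2`-vectors. [cite: Milne1999LefschetzClasses, Prop. 3.4 (p. 653)] -/
theorem Polarization.setOf_forall_lefschetzGroupBaseChange_map_eq_eq_adjoin [IsAlgClosed K] (hn : Odd n) :
    {x : ExteriorAlgebra K (K ⊗[ℚ] V) |
        ∀ γ ∈ Q.lefschetzGroupBaseChange K, ExteriorAlgebra.map (γ : (K ⊗[ℚ] V) →ₗ[K] (K ⊗[ℚ] V)) x = x} =
      Algebra.adjoin K {y : ExteriorAlgebra K (K ⊗[ℚ] V) | y ∈ ⋀[K]^2 (K ⊗[ℚ] V) ∧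
        ∀ γ ∈ Q.lefschetzGroupBaseChange K, ExteriorAlgebra.map (γ : (K ⊗[ℚ] V) →ₗ[K] (K ⊗[ℚ] V)) y = y} := by
  haveI : CharZero K := charZero_of_injective_algebraMap (algebraMap ℚ K).injective
  haveI := isSemisimpleRing_adjoin_baseChange_endAlg K H ⟨Q⟩
  exact Milne1999.setOf_forall_map_eq_eq_adjoin (Q.baseChange_form_nondegenerate K) (Q.baseChange_form_isAlt_of_odd K hn)
    (Algebra.adjoin K (Set.range fun a : H.endAlg ↦ (a : Module.End ℚ V).baseChange K))
    (fun X hX ↦ Q.exists_mem_adjoin_baseChange_form_apply K hX) (Q.lefschetzGroupBaseChange K)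
    (fun γ ↦ Q.mem_lefschetzGroupBaseChange_iff_forall_adjoin K γ)

omit [Module.Finite ℚ V] in
set_option maxSynthPendingDepth 4 in
/-- **Odd degrees carry no `S(H)(K)`-invariants, over EVERY field `K ⊇ ℚ`** (`−1 ∈ S(H)(K)` acts by `−1` on `⋀^m`, `m` odd;
"for odd `m`, `(H^{⊗m})^G = 0`"). [cite: Milne1999LefschetzClasses, §3 p. 654] -/
theorem Polarization.eq_zero_of_forall_lefschetzGroupBaseChange_map_eq_of_odd {m : ℕ} (hm : Odd m)
    {x : ExteriorAlgebra K (K ⊗[ℚ] V)} (hxm : x ∈ ⋀[K]^m (K ⊗[ℚ] V))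
    (hx : ∀ γ ∈ Q.lefschetzGroupBaseChange K, ExteriorAlgebra.map (γ : (K ⊗[ℚ] V) →ₗ[K] (K ⊗[ℚ] V)) x = x) : x = 0 := by
  haveI : CharZero K := charZero_of_injective_algebraMap (algebraMap ℚ K).injective
  exact Milne1999.eq_zero_of_forall_map_eq_of_odd
    (Algebra.adjoin K (Set.range fun a : H.endAlg ↦ (a : Module.End ℚ V).baseChange K)) (Q.lefschetzGroupBaseChange K)
    (fun γ ↦ Q.mem_lefschetzGroupBaseChange_iff_forall_adjoin K γ) hm hxm hx

end Main

end HodgeStructure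

end Literature.AlgebraicGeometry.Motives

end
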